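import Mathlib
import Literature.MathematicalPhysics.KineticTheory.HardSphereEulerProofs
import Literature.Analysis.FunctionSpaces.TorusCalculusProofs
import HarnessLib

/-!
# `StaticScoreResponse` (support item stmt-AtomisticToContinuum-12269): the score of the local
# Gibbs family along a smooth path of profiles

For jointly smooth profile paths `a, θ₀ : ℝ → 𝕋³ → ℝ`, `u₀ : ℝ → 𝕋³ → ℝ³` on the time set `[0,1]`
(`IsSmoothSpaceTimeOn (Icc 0 1)`) with `a, θ₀ > 0` there, the one-particle score of the local Gibbs
family — the `κ`-derivative (within `[0,1]`) of
`log localGibbsProfile (a κ) (u₀ κ) (θ₀ κ) (x, v) = log a + log M_{1, u₀, θ₀}(v)` — is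

`∂_κ log a + [ -(3/2) ∂_κθ₀/θ₀ + ⟪v - u₀, ∂_κu₀⟫/θ₀ + ‖v - u₀‖² ∂_κθ₀/(2θ₀²) ]`

(`derivWithin_log_localGibbsProfile`; all profiles at `(κ, x)`, `∂_κ = timeDerivWithin (Icc 0 1)`):
a POSITION part `g κ x = ∂_κ a/a` plus a VELOCITY part which is a polynomial of degree two in `v`
whose Maxwellian mean vanishes. Folklore (Gaussian score); no definitions, no named facts.
-/

noncomputable section

namespace Summit.AtomisticToContinuum.HydrodynamicLimit.Theorems

open MeasureTheory Set Filter Topology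
  Literature.Analysis.FluidPDE Literature.Analysis.FunctionSpaces.Torus Literature.MathematicalPhysics.KineticTheory
open scoped InnerProductSpace

variable {a θ₀ : ℝ → T3 → ℝ} {u₀ : ℝ → T3 → V3}

/-- The local Gibbs profile written out: `a(x) (2πθ(x))^{-3/2} exp(-‖v - u(x)‖²/(2θ(x)))`. [folklore] -/
theorem localGibbsProfile_eq (a₁ θ₁ : T3 → ℝ) (u₁ : T3 → V3) (x : T3) (v : V3) :
    localGibbsProfile a₁ u₁ θ₁ (x, v) =
      a₁ x * ((2 * Real.pi * θ₁ x) ^ (-(3 : ℝ) / 2) * Real.exp (-‖v - u₁ x‖ ^ 2 / (2 * θ₁ x))) := by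
  rw [localGibbsProfile, localMaxwellian, finrank_euclideanSpace_fin]
  push_cast
  ring

/-- The logarithm of the local Gibbs profile for positive activity and temperature:
`log a - (3/2) log(2πθ) - ‖v - u‖²/(2θ)`. [folklore] -/
theorem log_localGibbsProfile {a₁ θ₁ : T3 → ℝ} {u₁ : T3 → V3} {x : T3} (ha : 0 < a₁ x) (hθ : 0 < θ₁ x) (v : V3) :
    Real.log (localGibbsProfile a₁ u₁ θ₁ (x, v)) =
      Real.log (a₁ x) - 3 / 2 * Real.log (2 * Real.pi * θ₁ x) - ‖v - u₁ x‖ ^ 2 / (2 * θ₁ x) := by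
  have h2 : 0 < 2 * Real.pi * θ₁ x := by positivity
  rw [localGibbsProfile_eq, Real.log_mul ha.ne' (mul_pos (Real.rpow_pos_of_pos h2 _) (Real.exp_pos _)).ne',
    Real.log_mul (Real.rpow_pos_of_pos h2 _).ne' (Real.exp_pos _).ne', Real.log_rpow h2, Real.log_exp]
  ring

/-- **The score of the local Gibbs family along a smooth path of profiles.** For `κ ∈ [0,1]`:
`∂_κ log localGibbsProfile (a κ) (u₀ κ) (θ₀ κ) (x, v) =
 ∂_κa/a - (3/2) ∂_κθ₀/θ₀ + ⟪v - u₀, ∂_κu₀⟫/θ₀ + ‖v - u₀‖² ∂_κθ₀/(2θ₀²)` (derivative within `[0,1]`; all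
profiles and their `timeDerivWithin (Icc 0 1)` evaluated at `(κ, x)`). [folklore] -/
theorem hasDerivWithinAt_log_localGibbsProfile (ha : IsSmoothSpaceTimeOn (Icc 0 1) a)
    (hu : IsSmoothSpaceTimeOn (Icc 0 1) u₀) (hθ : IsSmoothSpaceTimeOn (Icc 0 1) θ₀)
    (hpos : ∀ κ ∈ Icc (0 : ℝ) 1, ∀ x, 0 < a κ x ∧ 0 < θ₀ κ x) {κ : ℝ} (hκ : κ ∈ Icc (0 : ℝ) 1) (x : T3) (v : V3) :
    HasDerivWithinAt (fun κ' => Real.log (localGibbsProfile (a κ') (u₀ κ') (θ₀ κ') (x, v)))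
      (timeDerivWithin (Icc 0 1) a κ x / a κ x
        - 3 / 2 * (timeDerivWithin (Icc 0 1) θ₀ κ x / θ₀ κ x)
        + ⟪v - u₀ κ x, timeDerivWithin (Icc 0 1) u₀ κ x⟫_ℝ / θ₀ κ x
        + ‖v - u₀ κ x‖ ^ 2 * timeDerivWithin (Icc 0 1) θ₀ κ x / (2 * (θ₀ κ x) ^ 2)) (Icc 0 1) κ := by
  obtain ⟨haκ, hθκ⟩ := hpos κ hκ x
  -- the pieces
  have ha' := ha.hasDerivWithinAt_slice hκ x
  have hu' := hu.hasDerivWithinAt_slice hκ x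
  have hθ' := hθ.hasDerivWithinAt_slice hκ x
  set da := timeDerivWithin (Icc 0 1) a κ x
  set du := timeDerivWithin (Icc 0 1) u₀ κ x
  set dθ := timeDerivWithin (Icc 0 1) θ₀ κ x
  -- `log a`
  have h1 : HasDerivWithinAt (fun κ' => Real.log (a κ' x)) (da / a κ x) (Icc 0 1) κ := ha'.log haκ.ne'
  -- `(3/2) log (2π θ)`
  have h2 : HasDerivWithinAt (fun κ' => 3 / 2 * Real.log (2 * Real.pi * θ₀ κ' x)) (3 / 2 * (dθ / θ₀ κ x)) (Icc 0 1) κ := by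
    have h := ((hθ'.const_mul (2 * Real.pi)).log (by positivity : 2 * Real.pi * θ₀ κ x ≠ 0)).const_mul (3 / 2)
    refine h.congr_deriv ?_
    have : Real.pi ≠ 0 := Real.pi_pos.ne'
    field_simp
  -- `‖v - u‖² / (2θ)`
  have h3 : HasDerivWithinAt (fun κ' => ‖v - u₀ κ' x‖ ^ 2 / (2 * θ₀ κ' x))
      ((2 * ⟪v - u₀ κ x, -du⟫_ℝ * (2 * θ₀ κ x) - ‖v - u₀ κ x‖ ^ 2 * (2 * dθ)) / (2 * θ₀ κ x) ^ 2) (Icc 0 1) κ := by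
    have hN : HasDerivWithinAt (fun κ' => ‖v - u₀ κ' x‖ ^ 2) (2 * ⟪v - u₀ κ x, -du⟫_ℝ) (Icc 0 1) κ := by
      have h := ((hasDerivWithinAt_const κ (Icc (0 : ℝ) 1) v).sub hu').norm_sq
      simpa using h
    exact hN.div (hθ'.const_mul 2) (by positivity)
  -- assemble on a neighbourhood within `[0,1]` where the logarithm splits
  have heq : ∀ κ' ∈ Icc (0 : ℝ) 1, Real.log (localGibbsProfile (a κ') (u₀ κ') (θ₀ κ') (x, v)) =
      Real.log (a κ' x) - 3 / 2 * Real.log (2 * Real.pi * θ₀ κ' x) - ‖v - u₀ κ' x‖ ^ 2 / (2 * θ₀ κ' x) :=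
    fun κ' hκ' => log_localGibbsProfile (hpos κ' hκ' x).1 (hpos κ' hκ' x).2 v
  refine (((h1.sub h2).sub h3).congr (fun κ' hκ' => heq κ' hκ') (heq κ hκ)).congr_deriv ?_
  rw [inner_neg_right]
  have hθ0 : θ₀ κ x ≠ 0 := hθκ.ne'
  field_simp
  ring

/-- **The score, `derivWithin` form** (the form appearing in the route statement). [folklore] -/
theorem derivWithin_log_localGibbsProfile (ha : IsSmoothSpaceTimeOn (Icc 0 1) a)
    (hu : IsSmoothSpaceTimeOn (Icc 0 1) u₀) (hθ : IsSmoothSpaceTimeOn (Icc 0 1) θ₀)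
    (hpos : ∀ κ ∈ Icc (0 : ℝ) 1, ∀ x, 0 < a κ x ∧ 0 < θ₀ κ x) {κ : ℝ} (hκ : κ ∈ Icc (0 : ℝ) 1) (x : T3) (v : V3) :
    derivWithin (fun κ' => Real.log (localGibbsProfile (a κ') (u₀ κ') (θ₀ κ') (x, v))) (Icc 0 1) κ =
      timeDerivWithin (Icc 0 1) a κ x / a κ x
        - 3 / 2 * (timeDerivWithin (Icc 0 1) θ₀ κ x / θ₀ κ x)
        + ⟪v - u₀ κ x, timeDerivWithin (Icc 0 1) u₀ κ x⟫_ℝ / θ₀ κ x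
        + ‖v - u₀ κ x‖ ^ 2 * timeDerivWithin (Icc 0 1) θ₀ κ x / (2 * (θ₀ κ x) ^ 2) :=
  (hasDerivWithinAt_log_localGibbsProfile ha hu hθ hpos hκ x v).derivWithin (uniqueDiffOn_Icc_zero_one κ hκ)

/-- **The velocity part of the score in Gaussian coordinates**: at `v = u₀ + √θ₀ w`,
`-(3/2) dθ/θ + ⟪v - u₀, du⟫/θ + ‖v - u₀‖² dθ/(2θ²) = -(3/2) dθ/θ + ⟪w, du⟫/√θ + ‖w‖² dθ/(2θ)`. [folklore] -/
theorem velocityScore_gauss {θ dθ : ℝ} (hθ : 0 < θ) (u du w : V3) :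
    -(3 / 2 * (dθ / θ)) + ⟪(u + Real.sqrt θ • w) - u, du⟫_ℝ / θ + ‖(u + Real.sqrt θ • w) - u‖ ^ 2 * dθ / (2 * θ ^ 2) =
      -(3 / 2 * (dθ / θ)) + ⟪w, du⟫_ℝ / Real.sqrt θ + ‖w‖ ^ 2 * dθ / (2 * θ) := by
  have hs : 0 < Real.sqrt θ := Real.sqrt_pos.2 hθ
  have hs2 : Real.sqrt θ ^ 2 = θ := Real.sq_sqrt hθ.le
  set s := Real.sqrt θ with hsdef
  rw [← hs2]
  rw [add_sub_cancel_left, inner_smul_left, norm_smul, Real.norm_eq_abs, abs_of_pos hs, mul_pow]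
  simp only [RCLike.conj_to_real]
  have hs0 : s ≠ 0 := hs.ne'
  field_simp

end Summit.AtomisticToContinuum.HydrodynamicLimit.Theorems

end
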